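import Summits.RiemannHypothesis.RiemannHypothesis.Theorems.DBNStripCorrector
import Mathlib.Analysis.Complex.RemovableSingularity
import HarnessLib

/-!
# RiemannHypothesis / DBN — the corner-free complexified descent kernel `G = 4/(1+w²) − π sech(πw/2)`

RH-FREE complex analysis for T13 (THEORY-R4 §2 of the `pub-dbn` cell).  `cornerFreeDescentC` is the
complexified descent kernel `Π₀(w) = 2[(1+iw)⁻¹ + (1−iw)⁻¹]` (`Re Π₀ = P`) minus the strip corrector
`π·(cosh(πw/2))⁻¹` (`Re = 2π·Q`); its simple poles at the corners `w = ±i` cancel, so by Mathlib's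
removable-singularity theorem (`Complex.differentiableOn_update_limUnder_of_bddAbove`) it extends to
`cornerFreeDescentExt`, holomorphic at every point of the closed strip `|Im w| ≤ 1`.  Proved here
(sorry-free, standard axioms): evenness, `Re G = P − 2πQ`, holomorphy away from the odd multiples of
`i`, boundedness on the punctured balls `B(±i, 1/4)`, holomorphy of the extension on the closed strip,
its boundary values `Re G̃(ξ ± i) = 4/(ξ²+4)` and corner values `Re G̃(±i) = 1` (by continuity along
the boundary line), and the far-field bound `‖G z‖ ≤ 4 + π` for `|Re z| ≥ 1`.

`--supports stmt-RiemannHypothesis-0274`; nothing here bears on the truth of RH.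
-/

noncomputable section

-- D-0017: `Summit.<S>.<S>.…` is the designed namespace of a single-problem summit.
set_option linter.dupNamespace false

open scoped Real
open Complex Set Filter Topology

namespace Summit.RiemannHypothesis.RiemannHypothesis.Theorems.DbnTheory
/-! ## The corner-free complexified descent kernel and its holomorphic extension across `±i` -/

/-- `G(w) = 2[(1+iw)⁻¹ + (1−iw)⁻¹] − π·(cosh(πw/2))⁻¹ = 4/(1+w²) − π sech(πw/2)`: the complexified
descent kernel minus the strip corrector; `Re G(ξ+iη) = P(ξ,η) − 2π·Q^{(η)}(ξ)`.  Its poles at the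
corners `w = ±i` cancel (`norm_corrected_le`). [folklore] -/
def cornerFreeDescentC (w : ℂ) : ℂ :=
  2 * (((1:ℂ) + I * w)⁻¹ + ((1:ℂ) - I * w)⁻¹) - (π : ℂ) * (Complex.cosh ((π : ℂ) * w / 2))⁻¹

/-- The holomorphic extension of `cornerFreeDescentC` across the two removable singularities `±i`
(values there = the limits). [folklore] -/
def cornerFreeDescentExt : ℂ → ℂ :=
  Function.update
    (Function.update cornerFreeDescentC I (limUnder (𝓝[≠] I) cornerFreeDescentC)) (-I)
    (limUnder (𝓝[≠] (-I)) (Function.update cornerFreeDescentC I (limUnder (𝓝[≠] I) cornerFreeDescentC)))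

/-- `G` is even. [folklore] -/
theorem cornerFreeDescentC_neg (w : ℂ) : cornerFreeDescentC (-w) = cornerFreeDescentC w := by
  unfold cornerFreeDescentC
  rw [show (π : ℂ) * -w / 2 = -((π : ℂ) * w / 2) by ring, Complex.cosh_neg, mul_neg, ← sub_eq_add_neg,
    sub_neg_eq_add, add_comm (((1:ℂ) - I * w)⁻¹)]

/-- Real part of `G`: `Re G(z) = P(Re z, Im z) − 2π·Q^{(Im z)}(Re z)` (at every `z`; at the corners both
sides take junk values consistently). [folklore] -/
theorem re_cornerFreeDescentC (z : ℂ) :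
    (cornerFreeDescentC z).re = descentKernel z.re z.im - 2 * π * stripKernel z.im z.re := by
  unfold cornerFreeDescentC
  rw [sub_re, re_corrector]
  congr 1
  have h2 : (2 : ℂ) = ((2 : ℝ) : ℂ) := by norm_num
  rw [h2, re_ofReal_mul, add_re, inv_re, inv_re, normSq_apply, normSq_apply]
  unfold descentKernel
  simp only [add_re, sub_re, mul_re, one_re, I_re, I_im, add_im, sub_im, mul_im, one_im,
    zero_mul, one_mul, zero_sub, zero_add]
  ring

/-- The zeros of `cosh(πz/2)` are the odd multiples of `i`. [folklore] -/
theorem cosh_pi_half_eq_zero {z : ℂ} (h0 : Complex.cosh ((π : ℂ) * z / 2) = 0) :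
    ∃ k : ℤ, z = ((2 * k + 1 : ℤ) : ℂ) * I := by
  have hn : normSq (Complex.cosh ((π : ℂ) * z / 2)) = 0 := by rw [h0, map_zero]
  rw [normSq_cosh_pi_half] at hn
  have hcosh1 : 1 ≤ Real.cosh (π * z.re / 2) := Real.one_le_cosh _
  have hsin1 : Real.sin (π * z.im / 2) ^ 2 ≤ 1 := by
    rw [sq_le_one_iff_abs_le_one]; exact Real.abs_sin_le_one _
  have hcosh_eq : Real.cosh (π * z.re / 2) = 1 := by nlinarith
  have hre : z.re = 0 := by
    by_contra hne
    have : 1 < Real.cosh (π * z.re / 2) := Real.one_lt_cosh.mpr (by positivity)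
    linarith
  have hsin_eq : Real.sin (π * z.im / 2) ^ 2 = 1 := by nlinarith
  have hcos : Real.cos (π * z.im / 2) = 0 := by
    have := Real.sin_sq_add_cos_sq (π * z.im / 2)
    nlinarith [sq_nonneg (Real.cos (π * z.im / 2))]
  obtain ⟨k, hk⟩ := Real.cos_eq_zero_iff.mp hcos
  refine ⟨k, Complex.ext ?_ ?_⟩
  · simp [hre]
  · have : z.im = 2 * k + 1 := by
      have hπ := Real.pi_pos
      field_simp at hk
      nlinarith
    simp [this]

/-- `G` is holomorphic away from the odd multiples of `i`. [folklore] -/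
theorem differentiableAt_cornerFreeDescentC {z : ℂ} (hz : ∀ k : ℤ, z ≠ ((2 * k + 1 : ℤ) : ℂ) * I) :
    DifferentiableAt ℂ cornerFreeDescentC z := by
  have h1 : (1:ℂ) + I * z ≠ 0 := by
    intro h
    apply hz 0
    have hre := congrArg Complex.re h
    have him := congrArg Complex.im h
    simp at hre him
    exact Complex.ext (by simp [him]) (by simp; linarith)
  have h2 : (1:ℂ) - I * z ≠ 0 := by
    intro h
    apply hz (-1)
    have hre := congrArg Complex.re h
    have him := congrArg Complex.im h
    simp at hre him
    exact Complex.ext (by simp [him]) (by simp; linarith)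
  have h3 : Complex.cosh ((π : ℂ) * z / 2) ≠ 0 := fun h0 => by
    obtain ⟨k, hk⟩ := cosh_pi_half_eq_zero h0; exact hz k hk
  unfold cornerFreeDescentC
  refine DifferentiableAt.sub (DifferentiableAt.const_mul (DifferentiableAt.fun_add ?_ ?_) _)
    (DifferentiableAt.const_mul ?_ _)
  · exact DifferentiableAt.inv (by fun_prop) h1
  · exact DifferentiableAt.inv (by fun_prop) h2
  · exact DifferentiableAt.inv (by fun_prop) h3

/-- Points of the punctured ball `B(i, 1/4) ∖ {i}` are not odd multiples of `i`. [folklore] -/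
theorem ne_odd_mul_I_of_mem_ball {z : ℂ} (hz : z ∈ Metric.ball I (1/4)) (hzI : z ≠ I) (k : ℤ) :
    z ≠ ((2 * k + 1 : ℤ) : ℂ) * I := by
  intro h
  rw [Metric.mem_ball, h, dist_eq_norm] at hz
  have hnorm : ‖((2 * k + 1 : ℤ) : ℂ) * I - I‖ = |(2 * k : ℝ)| := by
    rw [show ((2 * k + 1 : ℤ) : ℂ) * I - I = ((2 * k : ℝ) : ℂ) * I by push_cast; ring, norm_mul, norm_I,
      mul_one, norm_real, Real.norm_eq_abs]
  rw [hnorm] at hz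
  have hk : k = 0 := by
    have h1 : |(k : ℝ)| < 1 := by
      rw [abs_mul] at hz; norm_num at hz; linarith [abs_nonneg (k : ℝ)]
    have h2 : |k| < 1 := by exact_mod_cast h1
    have h3 := abs_lt.mp h2
    omega
  subst hk
  apply hzI
  rw [h]; push_cast; ring

/-- Points of the closed strip `|Im z| ≤ 1` other than `±i` are not odd multiples of `i`. [folklore] -/
theorem ne_odd_mul_I_of_abs_im_le {z : ℂ} (hz : |z.im| ≤ 1) (h1 : z ≠ I) (h2 : z ≠ -I) (k : ℤ) :
    z ≠ ((2 * k + 1 : ℤ) : ℂ) * I := by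
  intro h
  have him : z.im = 2 * k + 1 := by rw [h]; simp
  rw [him] at hz
  have hk : k = 0 ∨ k = -1 := by
    have := abs_le.mp hz
    have h3 : (k : ℝ) ≤ 0 := by linarith
    have h4 : (-1 : ℝ) ≤ k := by linarith
    have h5 : k ≤ 0 := by exact_mod_cast h3
    have h6 : -1 ≤ k := by exact_mod_cast h4
    omega
  rcases hk with hk | hk
  · subst hk; apply h1; rw [h]; push_cast; ring
  · subst hk; apply h2; rw [h]; push_cast; ring

/-- `G` is bounded on the punctured ball `B(i, 1/4) ∖ {i}` (the corner pole cancels). [folklore] -/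
theorem norm_cornerFreeDescentC_le_of_mem_ball {z : ℂ} (hz : z ∈ Metric.ball I (1/4)) (hzI : z ≠ I) :
    ‖cornerFreeDescentC z‖ ≤ 2 * π + 2 := by
  have ht : z - I ≠ 0 := sub_ne_zero.mpr hzI
  have hn : ‖z - I‖ ≤ 1/4 := by
    rw [Metric.mem_ball, dist_eq_norm] at hz; exact hz.le
  have h := norm_corrected_le (z - I) ht hn
  unfold cornerFreeDescentC
  rwa [show I + (z - I) = z by ring] at h

/-- `G` is bounded on the punctured ball `B(−i, 1/4) ∖ {−i}` (by evenness). [folklore] -/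
theorem norm_cornerFreeDescentC_le_of_mem_ball_neg {z : ℂ} (hz : z ∈ Metric.ball (-I) (1/4))
    (hzI : z ≠ -I) : ‖cornerFreeDescentC z‖ ≤ 2 * π + 2 := by
  rw [← cornerFreeDescentC_neg]
  refine norm_cornerFreeDescentC_le_of_mem_ball ?_ (fun h => hzI (by rw [← neg_neg z, h]))
  rw [Metric.mem_ball, dist_eq_norm] at hz ⊢
  rwa [show -z - I = -(z - -I) by ring, norm_neg]

/-- The once-extended function is holomorphic on `B(i, 1/4)`. [folklore] -/
theorem differentiableOn_update_I :
    DifferentiableOn ℂ (Function.update cornerFreeDescentC I (limUnder (𝓝[≠] I) cornerFreeDescentC))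
      (Metric.ball I (1/4)) := by
  refine Complex.differentiableOn_update_limUnder_of_bddAbove (Metric.ball_mem_nhds I (by norm_num)) ?_ ?_
  · intro z hz
    have hzI : z ≠ I := hz.2
    exact (differentiableAt_cornerFreeDescentC (ne_odd_mul_I_of_mem_ball hz.1 hzI)).differentiableWithinAt
  · refine ⟨2 * π + 2, ?_⟩
    rintro _ ⟨z, hz, rfl⟩
    exact norm_cornerFreeDescentC_le_of_mem_ball hz.1 hz.2

/-- The extension is holomorphic on `B(−i, 1/4)`. [folklore] -/
theorem differentiableOn_cornerFreeDescentExt_neg :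
    DifferentiableOn ℂ cornerFreeDescentExt (Metric.ball (-I) (1/4)) := by
  unfold cornerFreeDescentExt
  have hfar : ∀ z ∈ Metric.ball (-I) (1/4 : ℝ), z ≠ I := by
    intro z hz h
    rw [h, Metric.mem_ball, dist_eq_norm, show I - -I = (2:ℂ) * I by ring, norm_mul, Complex.norm_two,
      norm_I] at hz
    norm_num at hz
  refine Complex.differentiableOn_update_limUnder_of_bddAbove (Metric.ball_mem_nhds (-I) (by norm_num)) ?_ ?_
  · intro z hz
    have hzI : z ≠ -I := hz.2
    have hne : ∀ k : ℤ, z ≠ ((2 * k + 1 : ℤ) : ℂ) * I := fun k h => by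
      have hz' : -z ∈ Metric.ball I (1/4) := by
        have h1 := hz.1
        rw [Metric.mem_ball, dist_eq_norm] at h1 ⊢
        rwa [show -z - I = -(z - -I) by ring, norm_neg]
      have hzI' : -z ≠ I := fun h' => hzI (by rw [← neg_neg z, h'])
      refine ne_odd_mul_I_of_mem_ball hz' hzI' (-k - 1) ?_
      rw [h]; push_cast; ring
    have hd := differentiableAt_cornerFreeDescentC hne
    refine (hd.congr_of_eventuallyEq ?_).differentiableWithinAt
    filter_upwards [isOpen_ne.mem_nhds (hfar z hz.1)] with y hy
    exact Function.update_of_ne hy _ _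
  · refine ⟨2 * π + 2, ?_⟩
    rintro _ ⟨z, hz, rfl⟩
    simp only [Function.comp_apply, Function.update_of_ne (hfar z hz.1)]
    exact norm_cornerFreeDescentC_le_of_mem_ball_neg hz.1 hz.2


/-- Off the corners the extension is the original function. [folklore] -/
theorem cornerFreeDescentExt_of_ne {z : ℂ} (h1 : z ≠ I) (h2 : z ≠ -I) :
    cornerFreeDescentExt z = cornerFreeDescentC z := by
  unfold cornerFreeDescentExt
  rw [Function.update_of_ne h2, Function.update_of_ne h1]

/-- The extension is holomorphic at every point of the closed strip `|Im z| ≤ 1`. [folklore] -/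
theorem differentiableAt_cornerFreeDescentExt {z : ℂ} (hz : |z.im| ≤ 1) :
    DifferentiableAt ℂ cornerFreeDescentExt z := by
  by_cases hm : z ∈ Metric.ball (-I) (1/4)
  · exact differentiableOn_cornerFreeDescentExt_neg.differentiableAt (Metric.isOpen_ball.mem_nhds hm)
  by_cases hp : z ∈ Metric.ball I (1/4)
  · -- near `i` the extension agrees with the once-updated function
    have hfar : ∀ y ∈ Metric.ball I (1/4 : ℝ), y ≠ -I := by
      intro y hy h
      rw [h, Metric.mem_ball, dist_eq_norm, show -I - I = -((2:ℂ) * I) by ring, norm_neg, norm_mul,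
        Complex.norm_two, norm_I] at hy
      norm_num at hy
    have hd := differentiableOn_update_I.differentiableAt (Metric.isOpen_ball.mem_nhds hp)
    refine hd.congr_of_eventuallyEq ?_
    filter_upwards [Metric.isOpen_ball.mem_nhds hp] with y hy
    unfold cornerFreeDescentExt
    rw [Function.update_of_ne (hfar y hy)]
  · -- away from both corners the extension agrees with `G`
    have h1 : z ≠ I := fun h => hp (by rw [h]; exact Metric.mem_ball_self (by norm_num))
    have h2 : z ≠ -I := fun h => hm (by rw [h]; exact Metric.mem_ball_self (by norm_num))
    have hd := differentiableAt_cornerFreeDescentC (ne_odd_mul_I_of_abs_im_le hz h1 h2)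
    refine hd.congr_of_eventuallyEq ?_
    filter_upwards [isOpen_ne.mem_nhds h1, isOpen_ne.mem_nhds h2] with y hy1 hy2
    exact cornerFreeDescentExt_of_ne hy1 hy2

/-- `P(ξ, −1) = 4/(ξ²+4)` as well. [folklore] -/
theorem descentKernel_neg_one (ξ : ℝ) : descentKernel ξ (-1) = 4 / (ξ^2 + 4) := by
  unfold descentKernel
  ring

/-- On the boundary lines, off the corners, `Re G̃ = 4/(ξ²+4)`. [folklore] -/
theorem re_cornerFreeDescentExt_boundary {z : ℂ} (hz : |z.im| = 1) (hre : z.re ≠ 0) :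
    (cornerFreeDescentExt z).re = 4 / (z.re ^ 2 + 4) := by
  have h1 : z ≠ I := fun h => hre (by rw [h]; simp)
  have h2 : z ≠ -I := fun h => hre (by rw [h]; simp)
  rw [cornerFreeDescentExt_of_ne h1 h2]
  unfold cornerFreeDescentC
  rw [sub_re, re_corrector_of_abs_im_eq_one z hz, sub_zero]
  have h := re_cornerFreeDescentC z
  unfold cornerFreeDescentC at h
  rw [sub_re, re_corrector] at h
  -- `h : Π₀.re - 2πQ = P - 2πQ`
  have hP : (2 * (((1:ℂ) + I * z)⁻¹ + ((1:ℂ) - I * z)⁻¹)).re = descentKernel z.re z.im := by linarith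
  rw [hP]
  rcases abs_eq (zero_le_one) |>.mp hz with h' | h'
  · rw [h', descentKernel]; ring
  · rw [h', descentKernel_neg_one]

/-- **The corner values**: `Re G̃(±i) = 1` (continuity of the extension along the boundary line, on
which `Re G̃ = 4/(ξ²+4) → 1`). [folklore] -/
theorem re_cornerFreeDescentExt_corner {z : ℂ} (hz : |z.im| = 1) (hre : z.re = 0) :
    (cornerFreeDescentExt z).re = 1 := by
  -- the path `ξ ↦ ξ + z` along the boundary line through the corner `z`
  have hcont : ContinuousAt cornerFreeDescentExt z :=
    (differentiableAt_cornerFreeDescentExt hz.le).continuousAt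
  have hpath : Continuous fun ξ : ℝ => (ξ : ℂ) + z := by fun_prop
  have hp0 : Filter.Tendsto (fun ξ : ℝ => (ξ : ℂ) + z) (𝓝 0) (𝓝 z) := by
    have h := hpath.tendsto 0
    simpa using h
  have h1 : Filter.Tendsto (fun ξ : ℝ => (cornerFreeDescentExt ((ξ : ℂ) + z)).re) (𝓝[≠] 0)
      (𝓝 (cornerFreeDescentExt z).re) :=
    ((continuous_re.tendsto _).comp (hcont.tendsto.comp hp0)).mono_left nhdsWithin_le_nhds
  have h2 : Filter.Tendsto (fun ξ : ℝ => (cornerFreeDescentExt ((ξ : ℂ) + z)).re) (𝓝[≠] 0) (𝓝 1) := by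
    have hlim : Filter.Tendsto (fun ξ : ℝ => 4 / (ξ ^ 2 + 4)) (𝓝[≠] 0) (𝓝 1) := by
      have hc : Continuous fun ξ : ℝ => 4 / (ξ ^ 2 + 4) :=
        continuous_const.div (by fun_prop) fun ξ => by positivity
      have := (hc.tendsto 0).mono_left (nhdsWithin_le_nhds (s := {(0:ℝ)}ᶜ))
      norm_num at this
      exact this
    refine hlim.congr' ?_
    refine eventually_nhdsWithin_of_forall fun ξ hξ => ?_
    have hξ : ξ ≠ 0 := hξ
    show 4 / (ξ ^ 2 + 4) = (cornerFreeDescentExt ((ξ : ℂ) + z)).re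
    rw [re_cornerFreeDescentExt_boundary (z := (ξ : ℂ) + z) (by simpa using hz) (by simpa [hre] using hξ)]
    simp [hre]
  exact tendsto_nhds_unique h1 h2

/-- A priori bound far out on the strip: `‖G z‖ ≤ 4 + π` for `|Re z| ≥ 1` (there `|1 ± iz| ≥ |Re z|` and
`|cosh(πz/2)| ≥ |sinh(π Re z/2)| ≥ π/2`). [folklore] -/
theorem norm_cornerFreeDescentC_le_far {z : ℂ} (hz : 1 ≤ |z.re|) : ‖cornerFreeDescentC z‖ ≤ 4 + π := by
  have hA : ‖((1:ℂ) + I * z)⁻¹‖ ≤ 1 := by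
    rw [norm_inv]
    refine inv_le_one_of_one_le₀ ?_
    have := abs_im_le_norm ((1:ℂ) + I * z)
    simp at this
    linarith
  have hB : ‖((1:ℂ) - I * z)⁻¹‖ ≤ 1 := by
    rw [norm_inv]
    refine inv_le_one_of_one_le₀ ?_
    have := abs_im_le_norm ((1:ℂ) - I * z)
    simp at this
    linarith
  have hC : ‖(Complex.cosh ((π : ℂ) * z / 2))⁻¹‖ ≤ 1 := by
    rw [norm_inv]
    refine inv_le_one_of_one_le₀ ?_
    have hsq : 1 ≤ ‖Complex.cosh ((π : ℂ) * z / 2)‖ ^ 2 := by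
      rw [← Complex.normSq_eq_norm_sq, normSq_cosh_pi_half]
      have hs : Real.sin (π * z.im / 2) ^ 2 ≤ 1 := by
        rw [sq_le_one_iff_abs_le_one]; exact Real.abs_sin_le_one _
      have hc2 : Real.cosh (π * z.re / 2) ^ 2 = Real.sinh (π * z.re / 2) ^ 2 + 1 := Real.cosh_sq _
      have hsinh : π / 2 ≤ |Real.sinh (π * z.re / 2)| := by
        rw [Real.abs_sinh]
        have h1 : π / 2 ≤ |π * z.re / 2| := by
          rw [abs_div, abs_mul, abs_of_pos Real.pi_pos, abs_two]
          nlinarith [Real.pi_pos]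
        exact h1.trans (Real.self_le_sinh_iff.mpr (abs_nonneg _))
      have hπ : 1 ≤ π / 2 := by linarith [Real.two_le_pi]
      nlinarith [sq_abs (Real.sinh (π * z.re / 2))]
    nlinarith [norm_nonneg (Complex.cosh ((π : ℂ) * z / 2))]
  unfold cornerFreeDescentC
  have hπ : ‖(π : ℂ)‖ = π := by rw [norm_real, Real.norm_of_nonneg Real.pi_pos.le]
  calc ‖2 * (((1:ℂ) + I * z)⁻¹ + ((1:ℂ) - I * z)⁻¹) - (π : ℂ) * (Complex.cosh ((π : ℂ) * z / 2))⁻¹‖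
      ≤ ‖2 * (((1:ℂ) + I * z)⁻¹ + ((1:ℂ) - I * z)⁻¹)‖ + ‖(π : ℂ) * (Complex.cosh ((π : ℂ) * z / 2))⁻¹‖ :=
        norm_sub_le _ _
    _ ≤ 2 * (1 + 1) + π * 1 := by
        rw [norm_mul, Complex.norm_two, norm_mul, hπ]
        have := norm_add_le ((1:ℂ) + I * z)⁻¹ ((1:ℂ) - I * z)⁻¹
        nlinarith [Real.pi_pos, norm_nonneg ((Complex.cosh ((π : ℂ) * z / 2))⁻¹)]
    _ = 4 + π := by ring

end Summit.RiemannHypothesis.RiemannHypothesis.Theorems.DbnTheory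

end
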